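import Literature.Topology.FourManifolds.LefschetzHandlebodyEuler
import Literature.Topology.FourManifolds.PageSystemBetti
import HarnessLib

/-!
# The Euler count of a Lefschetz handlebody — discharged

`LefschetzHandlebodyEuler.lean` proves the dictionary fact E of the line `hurwitz-deletion-presentation`
(crux stmt-SmoothPoincare4-10507), `length_eq_bettiNumber_of_isLefschetzHandlebodyOver` (Gompf–Stipsicz
1999, §8.2: a ℚ-acyclic Lefschetz handlebody `X(P; w)` over a page with connected boundary has
`|w| = b₁(P)`), from the named fact E-d `finrank_singularHomology_one_eq_bettiNumber_of_isPageSystem`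
(first Betti number of an open book with identity monodromy and connected page boundary);
`PageSystemBetti.lean` proves E-d (`IsPageSystem.finrank_singularHomology_one_eq_bettiNumber`).
This file records the two `_holds` theorems, so that fact E is an unconditional tree theorem.
-/

noncomputable section

open scoped Manifold ContDiff

namespace Literature.Topology.FourManifolds

/-- **E-d holds**: the named fact `finrank_singularHomology_one_eq_bettiNumber_of_isPageSystem`
(b₁ of a closed 3-manifold whose open book is trivialised by a page system with connected page
boundary equals `b₁(P)`) is the theorem `IsPageSystem.finrank_singularHomology_one_eq_bettiNumber`
(`PageSystemBetti.lean`). [cite: EtnyreFuller2006, §2] -/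
theorem finrank_singularHomology_one_eq_bettiNumber_of_isPageSystem_holds :
    finrank_singularHomology_one_eq_bettiNumber_of_isPageSystem :=
  fun _ _ _ _ _ _ _ _ hP _ _ _ _ _ _ _ _ _ hJ =>
    IsPageSystem.finrank_singularHomology_one_eq_bettiNumber hP hJ

/-- **Fact E holds** (Gompf–Stipsicz 1999, §8.2; Kas 1980): a Lefschetz handlebody `W` of the
signed word `w` over a compact connected oriented page `P` with CONNECTED boundary which is
ℚ-acyclic in positive degrees has exactly `b₁(P)` vanishing cycles, `|w| = bettiNumber ℤ P 1`.
Unconditional: `length_eq_bettiNumber_of_isLefschetzHandlebodyOver_of_isPageSystemBetti` (E-a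
Euler count of a simultaneous 2-handle attachment, E-b Morse count of the 1-handlebody base, E-c
`b₁(∂B) = b₁(B)`) fed with E-d. [cite: GompfStipsiczGSM1999, §8.2] -/
theorem length_eq_bettiNumber_of_isLefschetzHandlebodyOver_holds :
    length_eq_bettiNumber_of_isLefschetzHandlebodyOver :=
  length_eq_bettiNumber_of_isLefschetzHandlebodyOver_of_isPageSystemBetti
    finrank_singularHomology_one_eq_bettiNumber_of_isPageSystem_holds

end Literature.Topology.FourManifolds

end
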